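import Literature.InformationTheory.QuantumCodes.QuantumExpanderNoisySyndrome
import HarnessLib

/-!
# Quantum expander codes: single-shot small-set-flip decoding SUSTAINS a quantum memory under repeated noisy
# rounds with adversarial per-round budgets (no error accumulation) — PROOF

Index of sources: `[cite: FawziGrospellierLeverrier2018FT]` = Fawzi–Grospellier–Leverrier, FOCS 2018 / arXiv:1808.03821: §1 (p0006
L8: "the small-set-flip decoding algorithm only uses a single noisy syndrome measurement and outputs an error with controlled
weight"), §2.4 (p0011: the simplified model of fault tolerance — "errors occurring at each time step on the physical qubits, and
errors on the results of the syndrome measurement"; eq. (syndromes) `σ_X := σ_X(E_X) ⊕ D_X`), §3.3 Cor. 16.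

Venture QEC (`Summits/Ventures/QEC/Expanders`), row 04 (`prover-qec-type-04` gen 8), line L-SSF-NOISY (PARTITION v2.48 D50.L8),
node N9. The Literature theorem `ssfDecoder_residual_le_of_syndromeError` (`QuantumExpanderNoisySyndrome.lean`, from FGL18b
Cor. 16 + Lemma 15): one round of ANY small-set-flip decoder of the tree (`IsSSFDecoder κ`, `0 < κ`, `2κ < min Δ·β₁`,
`β₁ = 1 − 16δ`) on ONE noisy syndrome `σ_X(E) ⊕ 𝟙_D` leaves a residual equivalent modulo `C_Z^⊥` to a word of weight
`≤ c|D|`, `c = 4/(min Δ·β₁ − 2κ)`, whenever `max Δ·(|E| + (max Δ|E| + |D|)/κ) ≤ min Δ·min(γ_A n_A, γ_B n_B)`. THIS FILE iterates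
it (OURS; deterministic, adversarial): in the memory experiment "each round: new qubit faults `f_t`, then one noisy syndrome
measurement with faults `D_t`, then the decoder's correction", with per-round budgets `|f_t| ≤ ε`, `|D_t| ≤ d` and the single
budget inequality `max Δ·((c d + ε) + (max Δ(c d + ε) + d)/κ) ≤ min Δ·min(γ_A n_A, γ_B n_B)`, the physical residual error after
EVERY round is equivalent modulo `C_Z^⊥` to a word of weight `≤ c·d` — uniformly in the number of rounds (the decoder sees only
the current round's syndrome; equivalent errors have equal syndromes, so the induction runs on the light representative).

* ★ `ssfDecoder_repeated_rounds_residual_le` — the statement above (`X`-sector);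
* `expanderHZ_mulVec_eq_zero_of_mem_rowSpace_expanderHX`, `ssfDecoder_repeated_rounds_residual_le_zsector` — the same for the
  other error type of `Q_G` (via `ssfDecoder_residual_le_of_syndromeError_zsector`).

STATUS: OURS (no printed counterpart in FGL18b, whose Thm. 13 is the STOCHASTIC one-round statement); ingredients cited. PROVED
(kernel axioms); no definitions (the round recursion is a hypothesis on a given state sequence), no named facts, 0 kit.
-/

namespace Summit.Ventures.QEC.Expanders

open Finset Matrix Literature.InformationTheory.QuantumCodes Literature.InformationTheory.QuantumCodes.QuantumExpander

variable {A B : Type*} [Fintype A] [Fintype B] [DecidableEq A] [DecidableEq B]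

omit [DecidableEq A] [DecidableEq B] in
/-- Subadditivity of the Hamming weight. [folklore] -/
private theorem hammingNorm_add_le₃ {ι : Type*} [Fintype ι] (x y : ι → ZMod 2) :
    hammingNorm (x + y) ≤ hammingNorm x + hammingNorm y := by
  have h := hammingDist_triangle (x + y) y 0
  have h1 : hammingDist (x + y) y = hammingNorm x := by
    rw [hammingDist_comm, hammingDist_eq_hammingNorm]
    congr 1; ext i; simp only [Pi.add_apply, Pi.neg_apply]; ring
  rw [hammingDist_zero_right, hammingDist_zero_right, h1] at h
  exact h

/-- ★ **Single-shot decoding sustains the memory (adversarial, any number of rounds).** Let `G` be `(Δ_A, Δ_B)`-biregular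
(`Δ ≥ 1`) and `(γ_A, δ_A, γ_B, δ_B)`-expanding, `δ = max(δ_A, δ_B) ≥ 0`, `β₁ = 1 − 16δ`, and let `Dec` be ANY small-set-flip
decoder of the tree with threshold `κ`, `0 < κ`, `2κ < min Δ·β₁`; put `c = 4/(min Δ·β₁ − 2κ)`. Consider a state sequence
`st : ℕ → 𝔽₂^V` with `st 0 = 0` and, each round, new qubit faults `f t`, a noisy syndrome with faults `Ds t`, and the
correction: `st (t+1) = (st t ⊕ f t) ⊕ Dec(σ_X(st t ⊕ f t) ⊕ 𝟙_{Ds t})`. If `|f t| ≤ ε` and `|Ds t| ≤ d` for all `t` and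
`max Δ·((c d + ε) + (max Δ·(c d + ε) + d)/κ) ≤ min Δ·min(γ_A n_A, γ_B n_B)`, then for EVERY `t` the residual `st t` is
equivalent modulo `C_Z^⊥` to a word of weight `≤ c·d`. Proof: induction on `t`; the decoder's input syndrome of round `t+1` is
that of the light representative `e'_t ⊕ f t` (weight `≤ c d + ε`), to which `ssfDecoder_residual_le_of_syndromeError`
applies. [cite: FawziGrospellierLeverrier2018FT, §1 (p0006 L8) and §2.4 (simplified model of fault tolerance; arXiv p0011), Cor 16] -/
theorem ssfDecoder_repeated_rounds_residual_le (H : Matrix B A (ZMod 2)) {dA dB : ℕ} {γA δA γB δB : ℝ}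
    (hreg : IsBiregular H dA dB) (hexp : IsLeftRightExpanding H dA dB γA δA γB δB)
    (hdA : 0 < dA) (hdB : 0 < dB) (hδA : 0 ≤ δA) (hδB : 0 ≤ δB)
    {κ : ℝ} (hκ0 : 0 < κ) (hκ1 : 2 * κ < ((min dA dB : ℕ) : ℝ) * (1 - 16 * max δA δB))
    (Dec : Decoder (A × B → ZMod 2) ((A × A) ⊕ (B × B) → ZMod 2))
    (hDec : IsSSFDecoder κ (expanderHX H) (expanderHZ H) Dec)
    (f : ℕ → (A × A) ⊕ (B × B) → ZMod 2) (Ds : ℕ → Finset (A × B)) (st : ℕ → (A × A) ⊕ (B × B) → ZMod 2)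
    (h0 : st 0 = 0)
    (hstep : ∀ t, st (t + 1) = (st t + f t) + Dec (expanderHX H *ᵥ (st t + f t) + flipVec (Ds t)))
    {ε d : ℝ} (hf : ∀ t, (hammingNorm (f t) : ℝ) ≤ ε) (hD : ∀ t, ((Ds t).card : ℝ) ≤ d)
    (hbudget : ((max dA dB : ℕ) : ℝ)
        * ((4 / (((min dA dB : ℕ) : ℝ) * (1 - 16 * max δA δB) - 2 * κ) * d + ε)
          + (((max dA dB : ℕ) : ℝ) * (4 / (((min dA dB : ℕ) : ℝ) * (1 - 16 * max δA δB) - 2 * κ) * d + ε) + d) / κ)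
      ≤ ((min dA dB : ℕ) : ℝ) * min (γA * Fintype.card A) (γB * Fintype.card B)) :
    ∀ t : ℕ, ∃ e' : (A × A) ⊕ (B × B) → ZMod 2, e' + st t ∈ rowSpace (expanderHZ H) ∧
      (hammingNorm e' : ℝ) ≤ 4 / (((min dA dB : ℕ) : ℝ) * (1 - 16 * max δA δB) - 2 * κ) * d := by
  classical
  set c : ℝ := 4 / (((min dA dB : ℕ) : ℝ) * (1 - 16 * max δA δB) - 2 * κ) with hcdef
  have hc0 : 0 ≤ c := by rw [hcdef]; apply div_nonneg (by norm_num); linarith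
  have hd0 : 0 ≤ d := le_trans (Nat.cast_nonneg _) (hD 0)
  have hdM' : (0 : ℝ) ≤ ((max dA dB : ℕ) : ℝ) := Nat.cast_nonneg _
  intro t
  induction t with
  | zero =>
    refine ⟨0, ?_, mul_nonneg hc0 hd0 |> fun h => by simpa using h⟩
    rw [h0, add_zero]; exact Submodule.zero_mem _
  | succ t ih =>
    obtain ⟨e', he', hle'⟩ := ih
    -- the light representative of the round's input error
    set g := e' + f t with hg
    have hgle : (hammingNorm g : ℝ) ≤ c * d + ε := by
      have h1 : (hammingNorm g : ℝ) ≤ hammingNorm e' + hammingNorm (f t) := by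
        exact_mod_cast hammingNorm_add_le₃ e' (f t)
      linarith [hf t]
    -- it has the same syndrome as the actual input `st t ⊕ f t`
    have hdiff : (st t + f t) + g ∈ rowSpace (expanderHZ H) := by
      have : (st t + f t) + g = e' + st t := by
        rw [hg]; funext q; simp only [Pi.add_apply]
        have key : ∀ s x e : ZMod 2, s + x + (e + x) = e + s := by decide
        exact key _ _ _
      rw [this]; exact he'
    have hsyn : expanderHX H *ᵥ (st t + f t) = expanderHX H *ᵥ g := by
      have h0' := expanderHX_mulVec_eq_zero_of_mem_rowSpace H hdiff
      rw [Matrix.mulVec_add] at h0'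
      have hneg : -(expanderHX H *ᵥ g) = expanderHX H *ᵥ g := funext fun i => ZMod.neg_eq_self_mod_two _
      rw [← hneg]; exact eq_neg_of_add_eq_zero_left h0'
    -- the single-shot theorem on the representative
    have hsmall : ((max dA dB : ℕ) : ℝ)
        * (hammingNorm g + (((max dA dB : ℕ) : ℝ) * hammingNorm g + (Ds t).card) / κ)
      ≤ ((min dA dB : ℕ) : ℝ) * min (γA * Fintype.card A) (γB * Fintype.card B) := by
      refine le_trans ?_ hbudget
      apply mul_le_mul_of_nonneg_left _ hdM'
      have h2 : (((max dA dB : ℕ) : ℝ) * hammingNorm g + (Ds t).card) / κ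
          ≤ (((max dA dB : ℕ) : ℝ) * (c * d + ε) + d) / κ := by
        apply div_le_div_of_nonneg_right _ hκ0.le
        nlinarith [hD t, hgle, hdM']
      linarith
    obtain ⟨e'', he'', hle''⟩ := ssfDecoder_residual_le_of_syndromeError H hreg hexp hdA hdB hδA hδB hκ0 hκ1
      Dec hDec g (Ds t) hsmall
    refine ⟨e'', ?_, hle''.trans (mul_le_mul_of_nonneg_left (hD t) hc0)⟩
    -- `e'' ⊕ st(t+1) = (e'' ⊕ g ⊕ Ê) ⊕ (st t ⊕ f t ⊕ g)`, both harmless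
    rw [hstep t, hsyn]
    have hsplit : e'' + (st t + f t + Dec (expanderHX H *ᵥ g + flipVec (Ds t)))
        = (e'' + (g + Dec (expanderHX H *ᵥ g + flipVec (Ds t)))) + ((st t + f t) + g) := by
      funext q; simp only [Pi.add_apply]
      have key : ∀ a s x D y : ZMod 2, a + (s + x + D) = a + (y + D) + (s + x + y) := by decide
      exact key _ _ _ _ _
    rw [hsplit]
    exact Submodule.add_mem _ he'' hdiff

/-- Vectors of `rowsp H_X` have zero `H_Z`-syndrome (`H_Z H_Xᵀ = (H_X H_Zᵀ)ᵀ = 0`), the dual of the tree's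
`expanderHX_mulVec_eq_zero_of_mem_rowSpace`. [cite: FawziGrospellierLeverrier2018, §2.3 (H_X H_Z^T = 0)] -/
theorem expanderHZ_mulVec_eq_zero_of_mem_rowSpace_expanderHX (H : Matrix B A (ZMod 2))
    {v : (A × A) ⊕ (B × B) → ZMod 2} (hv : v ∈ rowSpace (expanderHX H)) : expanderHZ H *ᵥ v = 0 := by
  have hZX : expanderHZ H * (expanderHX H)ᵀ = 0 := by
    have h := congrArg Matrix.transpose (expanderHX_mul_expanderHZ_transpose H)
    rw [Matrix.transpose_mul, Matrix.transpose_transpose, Matrix.transpose_zero] at h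
    exact h
  rw [mem_rowSpace_iff] at hv
  obtain ⟨y, rfl⟩ := hv
  rw [← Matrix.mulVec_transpose, Matrix.mulVec_mulVec, hZX, Matrix.zero_mulVec]

/-- **`Z`-sector twin** of `ssfDecoder_repeated_rounds_residual_le`: the same statement for the other error type of `Q_G` (decoders for syndromes `expanderHZ H`, harmless corrections `rowsp(expanderHX H)`, syndrome faults `Ds t ⊆ B × A`), from `ssfDecoder_residual_le_of_syndromeError_zsector`. Original docstring of the `X`-sector statement: Let `G` be `(Δ_A, Δ_B)`-biregular
(`Δ ≥ 1`) and `(γ_A, δ_A, γ_B, δ_B)`-expanding, `δ = max(δ_A, δ_B) ≥ 0`, `β₁ = 1 − 16δ`, and let `Dec` be ANY small-set-flip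
decoder of the tree with threshold `κ`, `0 < κ`, `2κ < min Δ·β₁`; put `c = 4/(min Δ·β₁ − 2κ)`. Consider a state sequence
`st : ℕ → 𝔽₂^V` with `st 0 = 0` and, each round, new qubit faults `f t`, a noisy syndrome with faults `Ds t`, and the
correction: `st (t+1) = (st t ⊕ f t) ⊕ Dec(σ_X(st t ⊕ f t) ⊕ 𝟙_{Ds t})`. If `|f t| ≤ ε` and `|Ds t| ≤ d` for all `t` and
`max Δ·((c d + ε) + (max Δ·(c d + ε) + d)/κ) ≤ min Δ·min(γ_A n_A, γ_B n_B)`, then for EVERY `t` the residual `st t` is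
equivalent modulo `C_Z^⊥` to a word of weight `≤ c·d`. Proof: induction on `t`; the decoder's input syndrome of round `t+1` is
that of the light representative `e'_t ⊕ f t` (weight `≤ c d + ε`), to which `ssfDecoder_residual_le_of_syndromeError`
applies. [cite: FawziGrospellierLeverrier2018FT, §1 (p0006 L8) and §2.4 (simplified model of fault tolerance; arXiv p0011), Cor 16] -/
theorem ssfDecoder_repeated_rounds_residual_le_zsector (H : Matrix B A (ZMod 2)) {dA dB : ℕ} {γA δA γB δB : ℝ}
    (hreg : IsBiregular H dA dB) (hexp : IsLeftRightExpanding H dA dB γA δA γB δB)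
    (hdA : 0 < dA) (hdB : 0 < dB) (hδA : 0 ≤ δA) (hδB : 0 ≤ δB)
    {κ : ℝ} (hκ0 : 0 < κ) (hκ1 : 2 * κ < ((min dA dB : ℕ) : ℝ) * (1 - 16 * max δA δB))
    (Dec : Decoder (B × A → ZMod 2) ((A × A) ⊕ (B × B) → ZMod 2))
    (hDec : IsSSFDecoder κ (expanderHZ H) (expanderHX H) Dec)
    (f : ℕ → (A × A) ⊕ (B × B) → ZMod 2) (Ds : ℕ → Finset (B × A)) (st : ℕ → (A × A) ⊕ (B × B) → ZMod 2)
    (h0 : st 0 = 0)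
    (hstep : ∀ t, st (t + 1) = (st t + f t) + Dec (expanderHZ H *ᵥ (st t + f t) + flipVec (Ds t)))
    {ε d : ℝ} (hf : ∀ t, (hammingNorm (f t) : ℝ) ≤ ε) (hD : ∀ t, ((Ds t).card : ℝ) ≤ d)
    (hbudget : ((max dA dB : ℕ) : ℝ)
        * ((4 / (((min dA dB : ℕ) : ℝ) * (1 - 16 * max δA δB) - 2 * κ) * d + ε)
          + (((max dA dB : ℕ) : ℝ) * (4 / (((min dA dB : ℕ) : ℝ) * (1 - 16 * max δA δB) - 2 * κ) * d + ε) + d) / κ)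
      ≤ ((min dA dB : ℕ) : ℝ) * min (γA * Fintype.card A) (γB * Fintype.card B)) :
    ∀ t : ℕ, ∃ e' : (A × A) ⊕ (B × B) → ZMod 2, e' + st t ∈ rowSpace (expanderHX H) ∧
      (hammingNorm e' : ℝ) ≤ 4 / (((min dA dB : ℕ) : ℝ) * (1 - 16 * max δA δB) - 2 * κ) * d := by
  classical
  set c : ℝ := 4 / (((min dA dB : ℕ) : ℝ) * (1 - 16 * max δA δB) - 2 * κ) with hcdef
  have hc0 : 0 ≤ c := by rw [hcdef]; apply div_nonneg (by norm_num); linarith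
  have hd0 : 0 ≤ d := le_trans (Nat.cast_nonneg _) (hD 0)
  have hdM' : (0 : ℝ) ≤ ((max dA dB : ℕ) : ℝ) := Nat.cast_nonneg _
  intro t
  induction t with
  | zero =>
    refine ⟨0, ?_, mul_nonneg hc0 hd0 |> fun h => by simpa using h⟩
    rw [h0, add_zero]; exact Submodule.zero_mem _
  | succ t ih =>
    obtain ⟨e', he', hle'⟩ := ih
    -- the light representative of the round's input error
    set g := e' + f t with hg
    have hgle : (hammingNorm g : ℝ) ≤ c * d + ε := by
      have h1 : (hammingNorm g : ℝ) ≤ hammingNorm e' + hammingNorm (f t) := by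
        exact_mod_cast hammingNorm_add_le₃ e' (f t)
      linarith [hf t]
    -- it has the same syndrome as the actual input `st t ⊕ f t`
    have hdiff : (st t + f t) + g ∈ rowSpace (expanderHX H) := by
      have : (st t + f t) + g = e' + st t := by
        rw [hg]; funext q; simp only [Pi.add_apply]
        have key : ∀ s x e : ZMod 2, s + x + (e + x) = e + s := by decide
        exact key _ _ _
      rw [this]; exact he'
    have hsyn : expanderHZ H *ᵥ (st t + f t) = expanderHZ H *ᵥ g := by
      have h0' := expanderHZ_mulVec_eq_zero_of_mem_rowSpace_expanderHX H hdiff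
      rw [Matrix.mulVec_add] at h0'
      have hneg : -(expanderHZ H *ᵥ g) = expanderHZ H *ᵥ g := funext fun i => ZMod.neg_eq_self_mod_two _
      rw [← hneg]; exact eq_neg_of_add_eq_zero_left h0'
    -- the single-shot theorem on the representative
    have hsmall : ((max dA dB : ℕ) : ℝ)
        * (hammingNorm g + (((max dA dB : ℕ) : ℝ) * hammingNorm g + (Ds t).card) / κ)
      ≤ ((min dA dB : ℕ) : ℝ) * min (γA * Fintype.card A) (γB * Fintype.card B) := by
      refine le_trans ?_ hbudget
      apply mul_le_mul_of_nonneg_left _ hdM'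
      have h2 : (((max dA dB : ℕ) : ℝ) * hammingNorm g + (Ds t).card) / κ
          ≤ (((max dA dB : ℕ) : ℝ) * (c * d + ε) + d) / κ := by
        apply div_le_div_of_nonneg_right _ hκ0.le
        nlinarith [hD t, hgle, hdM']
      linarith
    obtain ⟨e'', he'', hle''⟩ := ssfDecoder_residual_le_of_syndromeError_zsector H hreg hexp hdA hdB hδA hδB
      hκ0 hκ1 Dec hDec g (Ds t) hsmall
    refine ⟨e'', ?_, hle''.trans (mul_le_mul_of_nonneg_left (hD t) hc0)⟩
    -- `e'' ⊕ st(t+1) = (e'' ⊕ g ⊕ Ê) ⊕ (st t ⊕ f t ⊕ g)`, both harmless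
    rw [hstep t, hsyn]
    have hsplit : e'' + (st t + f t + Dec (expanderHZ H *ᵥ g + flipVec (Ds t)))
        = (e'' + (g + Dec (expanderHZ H *ᵥ g + flipVec (Ds t)))) + ((st t + f t) + g) := by
      funext q; simp only [Pi.add_apply]
      have key : ∀ a s x D y : ZMod 2, a + (s + x + D) = a + (y + D) + (s + x + y) := by decide
      exact key _ _ _ _ _
    rw [hsplit]
    exact Submodule.add_mem _ he'' hdiff

/-! ### The same statements in the printed "(α, β)-single-shot" vocabulary (appended; citations of the generic
### multi-round mechanism found by the cell's literature search, 2026-08-27) -/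

/-- **Small-set-flip is a `(0, β)`-single-shot decoder for quantum expander codes** in the sense of Gu–Tang–Caha–Choe–He–Kubica
(Def. 3.3: "a decoder is `(α,β)`-single-shot if `A|e|_R + B|D| ≤ Cn` implies `|e ⊕ f̂|_R ≤ α|e| + β|D|`"): with the LINEAR
budget `max Δ(κ + max Δ)·|E| + max Δ·|D| ≤ κ·min Δ·min(γ_A n_A, γ_B n_B)` (the budget of
`ssfDecoder_residual_le_of_syndromeError` multiplied by `κ`), every small-set-flip decoder of the tree (`0 < κ`, `2κ < min Δ·β₁`)
leaves a residual equivalent modulo `C_Z^⊥` to a word of weight `≤ β|D|`, `α = 0`, `β = 4/(min Δ·β₁ − 2κ)` (FGL18b Cor. 16's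
`c₀` at `β = 2κ/min Δ`). The expander-code INSTANCE with these constants is ours as packaging; the notion and the generic
consequences are in print. [cite: GuEtAl2023, Def 3.3 ((α,β)-single-shot decoder; arXiv:2306.12470 §3.3 p0008 L32-36)]
[cite: FawziGrospellierLeverrier2018FT, Cor 16 (arXiv p0016 L97 – p0017 L14)] [cite: Campbell2018, Def 1 ((p,q,f) single-shot; arXiv:1805.09271 p0004)] -/
theorem ssfDecoder_isSingleShot_zero_beta (H : Matrix B A (ZMod 2)) {dA dB : ℕ} {γA δA γB δB : ℝ}
    (hreg : IsBiregular H dA dB) (hexp : IsLeftRightExpanding H dA dB γA δA γB δB)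
    (hdA : 0 < dA) (hdB : 0 < dB) (hδA : 0 ≤ δA) (hδB : 0 ≤ δB)
    {κ : ℝ} (hκ0 : 0 < κ) (hκ1 : 2 * κ < ((min dA dB : ℕ) : ℝ) * (1 - 16 * max δA δB))
    (Dec : Decoder (A × B → ZMod 2) ((A × A) ⊕ (B × B) → ZMod 2))
    (hDec : IsSSFDecoder κ (expanderHX H) (expanderHZ H) Dec)
    (e : (A × A) ⊕ (B × B) → ZMod 2) (D : Finset (A × B))
    (hbudget : ((max dA dB : ℕ) : ℝ) * (κ + ((max dA dB : ℕ) : ℝ)) * hammingNorm e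
        + ((max dA dB : ℕ) : ℝ) * D.card
      ≤ κ * (((min dA dB : ℕ) : ℝ) * min (γA * Fintype.card A) (γB * Fintype.card B))) :
    ∃ e' : (A × A) ⊕ (B × B) → ZMod 2,
      e' + (e + Dec (expanderHX H *ᵥ e + flipVec D)) ∈ rowSpace (expanderHZ H) ∧
      (hammingNorm e' : ℝ) ≤ 4 / (((min dA dB : ℕ) : ℝ) * (1 - 16 * max δA δB) - 2 * κ) * D.card := by
  refine ssfDecoder_residual_le_of_syndromeError H hreg hexp hdA hdB hδA hδB hκ0 hκ1 Dec hDec e D ?_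
  -- divide the linear budget by `κ`
  have hM0 : (0 : ℝ) ≤ ((max dA dB : ℕ) : ℝ) := Nat.cast_nonneg _
  have hlhs : ((max dA dB : ℕ) : ℝ)
        * (hammingNorm e + (((max dA dB : ℕ) : ℝ) * hammingNorm e + D.card) / κ)
      = (((max dA dB : ℕ) : ℝ) * (κ + ((max dA dB : ℕ) : ℝ)) * hammingNorm e
          + ((max dA dB : ℕ) : ℝ) * D.card) / κ := by
    field_simp
    ring
  rw [hlhs, div_le_iff₀ hκ0]
  linarith

/-- **The multi-round statement in the printed form** (Gu–Tang–Caha–Choe–He–Kubica Thm. 3.5: "if `|e_i| ≤ Rn` and `|D_i| ≤ Sn`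
every round then the residual after each round satisfies `|e'_i|_R ≤ ((αR + βS)/(1 − α))n`", here `α = 0`; Campbell 2019 §1.2 and
Quintavalle–Vasmer–Roffe–Campbell 2021 §III eq. (tau_bound) give the same induction informally): `ssfDecoder_repeated_rounds_residual_le`
with its budget written linearly — per-round adversarial budgets `|f_t| ≤ ε`, `|D_t| ≤ d` and
`max Δ(κ + max Δ)(c d + ε) + max Δ·d ≤ κ·min Δ·min(γ_A n_A, γ_B n_B)`, `c = 4/(min Δ·β₁ − 2κ)`, give a residual equivalent to a word
of weight `≤ c·d` after EVERY round. The generic mechanism is in print (cited); the small-set-flip / expander instance with FGL18b's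
constants is ours as packaging. [cite: GuEtAl2023, Thm 3.5 (arXiv:2306.12470 §3.3 p0008 L66-90)] [cite: Campbell2018, §1.2 (N rounds; arXiv:1805.09271 p0005 L1-13)]
[cite: QuintavalleEtAl2020, §III eq. (tau_bound) (arXiv:2009.11790 p0006)] [cite: FawziGrospellierLeverrier2018FT, Cor 16] -/
theorem ssfDecoder_repeated_rounds_residual_le_linear (H : Matrix B A (ZMod 2)) {dA dB : ℕ} {γA δA γB δB : ℝ}
    (hreg : IsBiregular H dA dB) (hexp : IsLeftRightExpanding H dA dB γA δA γB δB)
    (hdA : 0 < dA) (hdB : 0 < dB) (hδA : 0 ≤ δA) (hδB : 0 ≤ δB)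
    {κ : ℝ} (hκ0 : 0 < κ) (hκ1 : 2 * κ < ((min dA dB : ℕ) : ℝ) * (1 - 16 * max δA δB))
    (Dec : Decoder (A × B → ZMod 2) ((A × A) ⊕ (B × B) → ZMod 2))
    (hDec : IsSSFDecoder κ (expanderHX H) (expanderHZ H) Dec)
    (f : ℕ → (A × A) ⊕ (B × B) → ZMod 2) (Ds : ℕ → Finset (A × B)) (st : ℕ → (A × A) ⊕ (B × B) → ZMod 2)
    (h0 : st 0 = 0)
    (hstep : ∀ t, st (t + 1) = (st t + f t) + Dec (expanderHX H *ᵥ (st t + f t) + flipVec (Ds t)))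
    {ε d : ℝ} (hf : ∀ t, (hammingNorm (f t) : ℝ) ≤ ε) (hD : ∀ t, ((Ds t).card : ℝ) ≤ d)
    (hbudget : ((max dA dB : ℕ) : ℝ) * (κ + ((max dA dB : ℕ) : ℝ))
          * (4 / (((min dA dB : ℕ) : ℝ) * (1 - 16 * max δA δB) - 2 * κ) * d + ε)
        + ((max dA dB : ℕ) : ℝ) * d
      ≤ κ * (((min dA dB : ℕ) : ℝ) * min (γA * Fintype.card A) (γB * Fintype.card B))) :
    ∀ t : ℕ, ∃ e' : (A × A) ⊕ (B × B) → ZMod 2, e' + st t ∈ rowSpace (expanderHZ H) ∧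
      (hammingNorm e' : ℝ) ≤ 4 / (((min dA dB : ℕ) : ℝ) * (1 - 16 * max δA δB) - 2 * κ) * d := by
  refine ssfDecoder_repeated_rounds_residual_le H hreg hexp hdA hdB hδA hδB hκ0 hκ1 Dec hDec f Ds st h0 hstep
    hf hD ?_
  have hlhs : ((max dA dB : ℕ) : ℝ)
        * ((4 / (((min dA dB : ℕ) : ℝ) * (1 - 16 * max δA δB) - 2 * κ) * d + ε)
          + (((max dA dB : ℕ) : ℝ) * (4 / (((min dA dB : ℕ) : ℝ) * (1 - 16 * max δA δB) - 2 * κ) * d + ε) + d)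
            / κ)
      = (((max dA dB : ℕ) : ℝ) * (κ + ((max dA dB : ℕ) : ℝ))
            * (4 / (((min dA dB : ℕ) : ℝ) * (1 - 16 * max δA δB) - 2 * κ) * d + ε)
          + ((max dA dB : ℕ) : ℝ) * d) / κ := by
    field_simp
    ring
  rw [hlhs, div_le_iff₀ hκ0]
  linarith

end Summit.Ventures.QEC.Expanders
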